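import Summits.CriticalPhenomena.PercolationContinuityZ3.Theorems.PercNearOneGluingNoHeavyLowerTailSahiCTCKleitmanCommonEdges
import HarnessLib

/-!
# `NoHeavyLowerTail` (crux stmt-CriticalPhenomena-4575), P3 lane: PIVOT CREDITS — an explicit lower bound for the Kleitman surplus of a sub-cube
# (`kap ≥ #{common pivot sets of a fixed free point}` for ANY two up-sets), and one extra credit over a base with a common loop (memo g48 §4c)

Support file (seat `prim-l12-p3`, gen 48; `--supports stmt-CriticalPhenomena-4575`).  Memo
`run/shared/lean/prim/prim-l12/FROM-prim-l12-p3-g48-THREE-BLOCK-SLOTS.md` §4c.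

Setting of `…SahiCTCKleitmanSurplus` / `…SahiCTCKleitmanCommonEdges` (base `D`, free set `s`, `kap 𝒳 𝒵 D s`).  For a free point `f ∈ s` the
PIVOT SETS of `f` are the `T ⊆ s ∖ {f}` with `D ∪ T` in neither family and `D ∪ T ∪ {f}` in both ("`f` is a common pivot at `D ∪ T`").
* **`card_pivotSets_le_kap`** : for ANY two up-sets, `#{pivot sets of f} ≤ kap 𝒳 𝒵 D s` (iterate the vertex recursion `kap_rec` at the points
  `≠ f`; on the one-point cube `{f}` the surplus is the pivot indicator, `one_le_kap_of_loop`).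
* **`card_pivotSets_add_one_le_kap_of_loop`** : over a base with a common loop, one more (the aligned pair `(s, ∅)`) when `D + f` is not common.
The strengthened Lemma A with explicit spare ("Lemma A-f") built on these is in `…SahiCTCKleitmanPivotCreditsAf`.
Nothing is asserted about the crux.
-/

namespace Summit.CriticalPhenomena.PercolationContinuityZ3.Theorems.SahiCTCForms

open Finset

variable {α : Type*} [DecidableEq α]

/-! ### Pivot sets and the universal lower bound -/

section Pivot
variable {𝒳 𝒵 : Finset (Finset α)}

/-- Membership in the set of pivot sets of `f` on the sub-cube `(D, s)`. [this work] -/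
theorem mem_pivotSets {D s : Finset α} {f : α} {T : Finset α} :
    T ∈ ((s.erase f).powerset.filter fun T => D ∪ T ∉ 𝒳 ∧ D ∪ T ∉ 𝒵 ∧ D ∪ insert f T ∈ 𝒳 ∧ D ∪ insert f T ∈ 𝒵) ↔
      T ⊆ s.erase f ∧ D ∪ T ∉ 𝒳 ∧ D ∪ T ∉ 𝒵 ∧ D ∪ insert f T ∈ 𝒳 ∧ D ∪ insert f T ∈ 𝒵 := by
  rw [mem_filter, mem_powerset]

/-- `(D + v) ∪ (T − v) = D ∪ T` when `v ∈ T`. [this work] -/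
theorem insert_union_erase_of_mem (D : Finset α) {T : Finset α} {v : α} (hv : v ∈ T) : insert v D ∪ T.erase v = D ∪ T :=
  insert_union_erase_eq D hv

/-- `(D + v) ∪ insert f (T − v) = D ∪ insert f T` when `v ∈ T`. [this work] -/
theorem insert_union_insert_erase_of_mem (D : Finset α) {T : Finset α} {v f : α} (hv : v ∈ T) :
    insert v D ∪ insert f (T.erase v) = D ∪ insert f T := by
  ext x; simp only [mem_union, mem_insert, mem_erase]
  constructor
  · rintro ((rfl | hx) | rfl | ⟨_, hx⟩)
    · exact Or.inr (Or.inr hv)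
    · exact Or.inl hx
    · exact Or.inr (Or.inl rfl)
    · exact Or.inr (Or.inr hx)
  · rintro (hx | rfl | hx)
    · exact Or.inl (Or.inr hx)
    · exact Or.inr (Or.inl rfl)
    · by_cases hxv : x = v
      · exact Or.inl (Or.inl hxv)
      · exact Or.inr (Or.inr ⟨hxv, hx⟩)

/-- **PIVOT CREDITS (any two up-sets).**  For a free point `f ∈ s`, the number of `T ⊆ s ∖ {f}` at which `f` is a common pivot over the base `D`
(`D ∪ T` in neither family, `D ∪ T ∪ {f}` in both) is at most the Kleitman surplus `kap 𝒳 𝒵 D s`. [this work] -/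
theorem card_pivotSets_le_kap (h𝒳 : IsUpperSet (𝒳 : Set (Finset α))) (h𝒵 : IsUpperSet (𝒵 : Set (Finset α))) :
    ∀ (n : ℕ) (s D : Finset α) (f : α), #s ≤ n → Disjoint D s → f ∈ s →
      (#((s.erase f).powerset.filter fun T => D ∪ T ∉ 𝒳 ∧ D ∪ T ∉ 𝒵 ∧ D ∪ insert f T ∈ 𝒳 ∧ D ∪ insert f T ∈ 𝒵) : ℤ)
        ≤ kap 𝒳 𝒵 D s := by
  intro n
  induction n with
  | zero =>
    intro s D f hs _ hf
    exact absurd (card_pos.2 ⟨f, hf⟩) (by omega)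
  | succ n ih =>
    intro s D f hs hDs hf
    by_cases h1 : s = {f}
    · -- the one-point cube `{f}`
      subst h1
      have hfD : f ∉ D := fun h => disjoint_left.1 hDs h (mem_singleton_self f)
      by_cases hp : D ∉ 𝒳 ∧ D ∉ 𝒵 ∧ insert f D ∈ 𝒳 ∧ insert f D ∈ 𝒵
      · have hle : #((({f} : Finset α).erase f).powerset.filter fun T =>
            D ∪ T ∉ 𝒳 ∧ D ∪ T ∉ 𝒵 ∧ D ∪ insert f T ∈ 𝒳 ∧ D ∪ insert f T ∈ 𝒵) ≤ 1 := by
          refine le_trans (card_le_card (filter_subset _ _)) ?_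
          rw [erase_singleton, powerset_empty, card_singleton]
        have h1 : (1 : ℤ) ≤ kap 𝒳 𝒵 D {f} := one_le_kap_of_loop h𝒳 h𝒵 hp.1 hp.2.1 (mem_singleton_self f) hp.2.2.1 hp.2.2.2
        have : (#((({f} : Finset α).erase f).powerset.filter fun T =>
            D ∪ T ∉ 𝒳 ∧ D ∪ T ∉ 𝒵 ∧ D ∪ insert f T ∈ 𝒳 ∧ D ∪ insert f T ∈ 𝒵) : ℤ) ≤ 1 := by exact_mod_cast hle
        linarith
      · have h0 : ((({f} : Finset α).erase f).powerset.filter fun T =>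
            D ∪ T ∉ 𝒳 ∧ D ∪ T ∉ 𝒵 ∧ D ∪ insert f T ∈ 𝒳 ∧ D ∪ insert f T ∈ 𝒵) = ∅ := by
          refine filter_eq_empty_iff.2 fun T hT h => hp ?_
          rw [erase_singleton, powerset_empty, mem_singleton] at hT
          subst hT
          rw [union_empty, union_insert, union_empty] at h
          exact h
        rw [h0, card_empty, Nat.cast_zero]
        exact kap_nonneg h𝒳 h𝒵 {f} D hDs
    · -- peel a point `v ≠ f`
      obtain ⟨v, hvs, hvf⟩ : ∃ v ∈ s, v ≠ f := by
        by_contra hcon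
        push Not at hcon
        exact h1 (eq_singleton_iff_unique_mem.2 ⟨hf, hcon⟩)
      have hvD : v ∉ D := fun h => disjoint_left.1 hDs h hvs
      set s' := s.erase v with hs'def
      have hs' : #s' ≤ n := by rw [hs'def, card_erase_of_mem hvs]; omega
      have hDs' : Disjoint D s' := Disjoint.mono_right (erase_subset v s) hDs
      have hDvs' : Disjoint (insert v D) s' := by rw [disjoint_insert_left]; exact ⟨notMem_erase v s, hDs'⟩
      have hfs' : f ∈ s' := mem_erase.2 ⟨hvf.symm, hf⟩
      rw [kap_rec h𝒳 h𝒵 hvs hvD]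
      have hJ : (0 : ℤ) ≤ #((tr 𝒳 (insert v D) s' \ tr 𝒳 D s').filter fun R =>
          s' \ R ∈ tr 𝒵 (insert v D) s' ∧ s' \ R ∉ tr 𝒵 D s') := Nat.cast_nonneg _
      have ih1 := ih s' D f hs' hDs' hfs'
      have ih2 := ih s' (insert v D) f hs' hDvs' hfs'
      -- split the pivot sets by `v ∈ T`
      set PS := (s.erase f).powerset.filter fun T => D ∪ T ∉ 𝒳 ∧ D ∪ T ∉ 𝒵 ∧ D ∪ insert f T ∈ 𝒳 ∧ D ∪ insert f T ∈ 𝒵 with hPS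
      have hsplit : #PS = #(PS.filter fun T => v ∉ T) + #(PS.filter fun T => v ∈ T) := by
        rw [← card_filter_add_card_filter_not (s := PS) (fun T => v ∉ T)]
        congr 2; ext T; simp only [mem_filter, not_not]
      have hA : #(PS.filter fun T => v ∉ T) ≤
          #((s'.erase f).powerset.filter fun T => D ∪ T ∉ 𝒳 ∧ D ∪ T ∉ 𝒵 ∧ D ∪ insert f T ∈ 𝒳 ∧ D ∪ insert f T ∈ 𝒵) := by
        refine card_le_card fun T hT => ?_
        obtain ⟨hT, hvT⟩ := mem_filter.1 hT
        obtain ⟨hTs, h⟩ := mem_pivotSets.1 hT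
        refine mem_pivotSets.2 ⟨fun x hx => ?_, h⟩
        have := mem_erase.1 (hTs hx)
        exact mem_erase.2 ⟨this.1, mem_erase.2 ⟨fun h => hvT (h ▸ hx), this.2⟩⟩
      have hB : #(PS.filter fun T => v ∈ T) ≤
          #((s'.erase f).powerset.filter fun T => insert v D ∪ T ∉ 𝒳 ∧ insert v D ∪ T ∉ 𝒵 ∧
            insert v D ∪ insert f T ∈ 𝒳 ∧ insert v D ∪ insert f T ∈ 𝒵) := by
        refine card_le_card_of_injOn (fun T => T.erase v) (fun T hT => ?_) (fun T hT T' hT' h => ?_)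
        · obtain ⟨hT, hvT⟩ := mem_filter.1 (mem_coe.1 hT)
          obtain ⟨hTs, h⟩ := mem_pivotSets.1 hT
          refine mem_coe.2 (mem_pivotSets.2 ⟨fun x hx => ?_, ?_⟩)
          · have hx' := mem_erase.1 hx
            have := mem_erase.1 (hTs hx'.2)
            exact mem_erase.2 ⟨this.1, mem_erase.2 ⟨hx'.1, this.2⟩⟩
          · rw [insert_union_erase_of_mem D hvT, insert_union_insert_erase_of_mem D hvT]; exact h
        · have h1 : v ∈ T := (mem_filter.1 (mem_coe.1 hT)).2
          have h2 : v ∈ T' := (mem_filter.1 (mem_coe.1 hT')).2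
          have h' : T.erase v = T'.erase v := h
          rw [← insert_erase h1, h', insert_erase h2]
      have : (#PS : ℤ) ≤ kap 𝒳 𝒵 D s' + kap 𝒳 𝒵 (insert v D) s' := by
        have := hsplit ▸ Nat.add_le_add hA hB
        have hcast : (#PS : ℤ) ≤ (#((s'.erase f).powerset.filter fun T => D ∪ T ∉ 𝒳 ∧ D ∪ T ∉ 𝒵 ∧ D ∪ insert f T ∈ 𝒳 ∧ D ∪ insert f T ∈ 𝒵) : ℤ)
            + #((s'.erase f).powerset.filter fun T => insert v D ∪ T ∉ 𝒳 ∧ insert v D ∪ T ∉ 𝒵 ∧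
              insert v D ∪ insert f T ∈ 𝒳 ∧ insert v D ∪ insert f T ∈ 𝒵) := by exact_mod_cast this
        linarith
      linarith

end Pivot

/-! ### The surplus over a base with a common loop pays the pivot sets and one more -/

section Loop
variable {𝒳 𝒵 : Finset (Finset α)} {D s : Finset α}

/-- Over a base `D` in neither family with a common loop `u ∈ s` (`D + u` in both), the surplus is at least the number of pivot sets of any free
`f` PLUS ONE, provided `D + f` is not a common member (then `∅` is not a pivot set and the aligned pair `(s, ∅)` is extra). [this work] -/
theorem card_pivotSets_add_one_le_kap_of_loop (h𝒳 : IsUpperSet (𝒳 : Set (Finset α))) (h𝒵 : IsUpperSet (𝒵 : Set (Finset α)))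
    (hD𝒳 : D ∉ 𝒳) (hD𝒵 : D ∉ 𝒵) {u : α} (hu : u ∈ s) (hu𝒳 : insert u D ∈ 𝒳) (hu𝒵 : insert u D ∈ 𝒵) (f : α)
    (hf : ¬ (D ∪ insert f ∅ ∈ 𝒳 ∧ D ∪ insert f ∅ ∈ 𝒵)) :
    (#((s.erase f).powerset.filter fun T => D ∪ T ∉ 𝒳 ∧ D ∪ T ∉ 𝒵 ∧ D ∪ insert f T ∈ 𝒳 ∧ D ∪ insert f T ∈ 𝒵) : ℤ) + 1
      ≤ kap 𝒳 𝒵 D s := by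
  rw [kap_eq_pairs]
  -- no negative pairs (common loop)
  have hneg : ((tr 𝒳 D s \ tr 𝒵 D s).filter fun U => s \ U ∈ tr 𝒵 D s ∧ s \ U ∉ tr 𝒳 D s) = ∅ := by
    refine filter_eq_empty_iff.2 fun U hU h => ?_
    obtain ⟨hUX, hUZ⟩ := mem_sdiff.1 hU
    have hUs := subset_of_mem_tr hUX
    by_cases huU : u ∈ U
    · exact hUZ (mem_tr.2 ⟨hUs, h𝒵 (by
        intro x hx; rcases mem_insert.1 hx with rfl | hx
        · exact mem_union_right _ huU
        · exact mem_union_left _ hx) hu𝒵⟩)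
    · exact h.2 (mem_tr.2 ⟨sdiff_subset, h𝒳 (by
        intro x hx; rcases mem_insert.1 hx with rfl | hx
        · exact mem_union_right _ (mem_sdiff.2 ⟨hu, huU⟩)
        · exact mem_union_left _ hx) hu𝒳⟩)
  rw [hneg, card_empty, Nat.cast_zero, sub_zero]
  set PS := (s.erase f).powerset.filter fun T => D ∪ T ∉ 𝒳 ∧ D ∪ T ∉ 𝒵 ∧ D ∪ insert f T ∈ 𝒳 ∧ D ∪ insert f T ∈ 𝒵 with hPS
  have h0 : (∅ : Finset α) ∉ PS := fun h => hf ⟨(mem_pivotSets.1 h).2.2.2.1, (mem_pivotSets.1 h).2.2.2.2⟩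
  have hcard : #(insert ∅ PS) = #PS + 1 := card_insert_of_notMem h0
  have hle : #(insert ∅ PS) ≤ #((tr 𝒳 D s ∩ tr 𝒵 D s).filter fun U => s \ U ∉ tr 𝒳 D s ∧ s \ U ∉ tr 𝒵 D s) := by
    refine card_le_card_of_injOn (fun T => s \ T) (fun T hT => ?_) (fun T hT T' hT' h => ?_)
    · have hT' := mem_coe.1 hT
      -- `T ⊆ s`, `D ∪ T` in neither, and `u ∉ T`
      have hTs : T ⊆ s ∧ D ∪ T ∉ 𝒳 ∧ D ∪ T ∉ 𝒵 := by
        rcases mem_insert.1 hT' with rfl | hT'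
        · exact ⟨empty_subset _, by rwa [union_empty], by rwa [union_empty]⟩
        · obtain ⟨hTs, hTX, hTZ, -⟩ := mem_pivotSets.1 hT'
          exact ⟨hTs.trans (erase_subset f s), hTX, hTZ⟩
      obtain ⟨hTs, hTX, hTZ⟩ := hTs
      have huT : u ∉ T := fun huT => hTX (h𝒳 (by
        intro x hx; rcases mem_insert.1 hx with rfl | hx
        · exact mem_union_right _ huT
        · exact mem_union_left _ hx) hu𝒳)
      have hsub : insert u D ⊆ D ∪ (s \ T) := by
        intro x hx; rcases mem_insert.1 hx with rfl | hx
        · exact mem_union_right _ (mem_sdiff.2 ⟨hu, huT⟩)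
        · exact mem_union_left _ hx
      refine mem_coe.2 (mem_filter.2 ⟨mem_inter.2 ⟨mem_tr.2 ⟨sdiff_subset, h𝒳 hsub hu𝒳⟩, mem_tr.2 ⟨sdiff_subset, h𝒵 hsub hu𝒵⟩⟩, ?_, ?_⟩)
        <;> rw [Finset.sdiff_sdiff_eq_self hTs, mem_tr]
      · exact fun h => hTX h.2
      · exact fun h => hTZ h.2
    · have h1 : T ⊆ s := by
        rcases mem_insert.1 (mem_coe.1 hT) with rfl | hT
        · exact empty_subset _
        · exact (mem_pivotSets.1 hT).1.trans (erase_subset f s)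
      have h2 : T' ⊆ s := by
        rcases mem_insert.1 (mem_coe.1 hT') with rfl | hT'
        · exact empty_subset _
        · exact (mem_pivotSets.1 hT').1.trans (erase_subset f s)
      have h' : s \ T = s \ T' := h
      rw [← Finset.sdiff_sdiff_eq_self h1, h', Finset.sdiff_sdiff_eq_self h2]
  have : (#PS : ℤ) + 1 = #(insert ∅ PS) := by rw [hcard]; push_cast; ring
  rw [this]; exact_mod_cast hle

end Loop

end Summit.CriticalPhenomena.PercolationContinuityZ3.Theorems.SahiCTCForms
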